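import Summits.BirchSwinnertonDyer.BirchSwinnertonDyer.Theorems.PrintCf2SplitBadTwoCMShaLocalScalarInput
import HarnessLib

/-!
# Crux `PrintCf2.SplitBadTwoRankOneOfFacts` (item stmt-BirchSwinnertonDyer-20368), road α, S3c₂: the local CM input (H1-pts) with ARBITRARY
# torsion — prime-to-`p` torsion of `E(K_v)` is absorbed (Bézout), so T4 may deliver «`(f_v − N₁) y ∈ p^n E(K_v) + E(K_v)_tors`»

Cell `bsd-print-cf2`, width seat `bsd-line-cf2-p1-w8` g2 (brick **B6g**, convenience form); `--supports stmt-BirchSwinnertonDyer-20368` (helper,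
Theses-free). HONEST FRAMING: nothing here closes a crux or a stub; BSD is not proved by any of this; no summit statement is proved by this
seat. No definition, no named fact, no `sorry`. beyond-print theorem: no.

* `cmScalar_localPoints_of_torsion` — if for every rational `y` and every `n` there are a rational `y′`, `N₁ ≡ 1 − r (mod p^n)` and an
  integer `m ≠ 0` with `m · (f_v y − N₁ y − p^n y′) = 0`, then the same holds with `m` a power of `p` (after changing `y′`): write
  `|m| = p^a m′`, `p ∤ m′`, `A m′ + B p^n = 1`; then `t − p^n (B t) = A m′ t` is killed by `p^a` (`t` the torsion point, rational).
* `comap_localKerOver_le_ker_resOfLe_of_cmScalar_torsion` — (H1″) from the arbitrary-torsion form (p670747).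

References: R. Greenberg, LNM 1716 (1999) §2 [GreenbergLNM1716]; K. Rubin, LNM 1716 (1999) §3 [Rubin1999].
-/

noncomputable section

open scoped Classical

set_option linter.dupNamespace false
set_option autoImplicit false

open NumberField IsDedekindDomain Field
open Literature.NumberTheory.EllipticCurves Literature.NumberTheory.EllipticCurves.GreenbergSelmer
open Literature.NumberTheory.EllipticCurves.Agboola2007
open Literature.NumberTheory.EllipticCurves.ResKernel
open Literature.NumberTheory.GaloisRepresentations
open Summit.BirchSwinnertonDyer.BirchSwinnertonDyer.Theorems.PrintCf2.RestrictedSelmerPair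

universe u

namespace Summit.BirchSwinnertonDyer.BirchSwinnertonDyer.Theorems.PrintCf2.CMPrimes

section Local

variable {K : Type u} [Field K] [NumberField K] (V : WeierstrassCurve K) [V.IsElliptic] (p : ℕ) [Fact p.Prime]
  (π : V.endRing) (r : ℤ_[p]) (v : HeightOneSpectrum (𝓞 K))

omit [V.IsElliptic] in
/-- **Prime-to-`p` torsion is absorbed.** From the arbitrary-torsion form of the CM scalar statement («`m · (f_v y − N₁ y − p^n y′) = 0` for some
integer `m ≠ 0`») to the `p`-power form (H1-pts) used by `comap_localKerOver_le_ker_resOfLe_of_cmScalar`: `|m| = p^a m′` with `p ∤ m′`, Bézout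
`A m′ + B p^n = 1`, replace `y′` by `y′ + B t`; then the new torsion point `A m′ t` is killed by `p^a`. [cite: GreenbergLNM1716, §2 Prop. 2.1 (p. 72)] -/
theorem cmScalar_localPoints_of_torsion
    (fE : localPoints V (v.adicCompletion K) →+ localPoints V (v.adicCompletion K))
    (hfE : ∀ (τ : absoluteGaloisGroup (v.adicCompletion K)) (P : localPoints V (v.adicCompletion K)), fE (τ • P) = τ • fE P)
    (H : ∀ y : localPoints V (v.adicCompletion K), (∀ σ : absoluteGaloisGroup (v.adicCompletion K), σ • y = y) →
      ∀ n : ℕ, ∃ (y' : localPoints V (v.adicCompletion K)) (N₁ : ℤ) (m : ℤ),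
        (∀ σ : absoluteGaloisGroup (v.adicCompletion K), σ • y' = y') ∧ m ≠ 0 ∧
        ((N₁ : ℤ_[p]) - (1 - r)) ∈ (Ideal.span {(p : ℤ_[p]) ^ n} : Ideal ℤ_[p]) ∧
        m • (fE y - N₁ • y - p ^ n • y') = 0) :
    ∀ y : localPoints V (v.adicCompletion K), (∀ σ : absoluteGaloisGroup (v.adicCompletion K), σ • y = y) →
      ∀ n : ℕ, ∃ (y' : localPoints V (v.adicCompletion K)) (N₁ : ℤ) (k : ℕ),
        (∀ σ : absoluteGaloisGroup (v.adicCompletion K), σ • y' = y') ∧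
        ((N₁ : ℤ_[p]) - (1 - r)) ∈ (Ideal.span {(p : ℤ_[p]) ^ n} : Ideal ℤ_[p]) ∧
        p ^ k • (fE y - N₁ • y - p ^ n • y') = 0 := by
  intro y hy n
  obtain ⟨y', N₁, m, hy', hm0, hN₁, hm⟩ := H y hy n
  set t : localPoints V (v.adicCompletion K) := fE y - N₁ • y - p ^ n • y' with htdef
  have hp : p.Prime := Fact.out
  -- `|m| = p^a m'`, `p ∤ m'`
  obtain ⟨a, m', hm', hfac⟩ := Nat.exists_eq_pow_mul_and_not_dvd (Int.natAbs_ne_zero.mpr hm0) p hp.one_lt.ne'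
  have habs : (m.natAbs : ℤ) • t = 0 := by
    rcases Int.natAbs_eq m with h | h
    · rw [← h]; exact hm
    · have : (m.natAbs : ℤ) = -m := by omega
      rw [this, neg_smul, hm, neg_zero]
  have hkill : ((p ^ a * m' : ℕ) : ℤ) • t = 0 := by rw [← hfac]; exact habs
  -- Bézout `A m' + B p^n = 1`
  have hcop : IsCoprime (m' : ℤ) ((p ^ n : ℕ) : ℤ) :=
    Nat.isCoprime_iff_coprime.mpr (((Nat.Prime.coprime_iff_not_dvd hp).mpr hm').symm.pow_right n)
  obtain ⟨A, B, hAB⟩ := hcop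
  -- `t` is rational
  have ht : ∀ σ : absoluteGaloisGroup (v.adicCompletion K), σ • t = t := fun σ ↦ by
    rw [htdef, smul_sub, smul_sub, ← hfE, hy σ, smul_comm σ N₁ y, hy σ, smul_comm σ (p ^ n) y', hy' σ]
  refine ⟨y' + B • t, N₁, a, fun σ ↦ by rw [smul_add, hy' σ, smul_comm σ B t, ht σ], hN₁, ?_⟩
  -- `fE y - N₁ y - p^n (y' + B t) = t - p^n B t = A m' t`, killed by `p^a`
  have e1 : fE y - N₁ • y - p ^ n • (y' + B • t) = (A * m') • t := by
    have e2 : (A * m') • t = t - ((p ^ n : ℕ) : ℤ) • (B • t) := by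
      rw [eq_sub_iff_add_eq, smul_smul, ← add_smul]
      conv_rhs => rw [← one_smul ℤ t]
      congr 1
      linear_combination hAB
    rw [e2, natCast_zsmul, htdef, smul_add]
    abel
  rw [e1, ← natCast_zsmul, smul_smul]
  have e3 : ((p ^ a : ℕ) : ℤ) * (A * m') = A * ((p ^ a * m' : ℕ) : ℤ) := by push_cast; ring
  rw [e3, mul_smul, hkill, smul_zero]

/-- **(H1″) from the arbitrary-torsion CM scalar statement** (p670747 `comap_localKerOver_le_ker_resOfLe_of_cmScalar` +
`cmScalar_localPoints_of_torsion`). [cite: GreenbergLNM1716, §2 Prop. 2.1–2.2 (pp. 70–73)] -/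
theorem comap_localKerOver_le_ker_resOfLe_of_cmScalar_torsion
    (hinf : V.endEigenPrimaryTorsion p π r ⊓ V.endEigenPrimaryTorsion p π (1 - r) = ⊥)
    (hsup : V.endEigenPrimaryTorsion p π r ⊔ V.endEigenPrimaryTorsion p π (1 - r) = ⊤) (hunit : IsUnit (r - (1 - r)))
    (fE : localPoints V (v.adicCompletion K) →+ localPoints V (v.adicCompletion K))
    (hfE : ∀ (τ : absoluteGaloisGroup (v.adicCompletion K)) (P : localPoints V (v.adicCompletion K)), fE (τ • P) = τ • fE P)
    (hfEπ : ∀ P : V.geomPoints, fE (pointsMap V (v.adicCompletion K) P) =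
      pointsMap V (v.adicCompletion K) ((π : AddMonoid.End V.geomPoints) P))
    (H : ∀ y : localPoints V (v.adicCompletion K), (∀ σ : absoluteGaloisGroup (v.adicCompletion K), σ • y = y) →
      ∀ n : ℕ, ∃ (y' : localPoints V (v.adicCompletion K)) (N₁ : ℤ) (m : ℤ),
        (∀ σ : absoluteGaloisGroup (v.adicCompletion K), σ • y' = y') ∧ m ≠ 0 ∧
        ((N₁ : ℤ_[p]) - (1 - r)) ∈ (Ideal.span {(p : ℤ_[p]) ^ n} : Ideal ℤ_[p]) ∧
        m • (fE y - N₁ • y - p ^ n • y') = 0) :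
    (V.localKerOver p ⊤ (v.adicCompletion K)).comap
        (resH1Hom (ContinuousMonoidHom.id _) (V.endEigenPrimaryTorsion p π r).subtype (fun _ _ ↦ rfl)) ≤
      (resOfLe ↥(V.endEigenPrimaryTorsion p π r) (inf_le_left : ⊤ ⊓ decomp v ≤ ⊤)).ker :=
  comap_localKerOver_le_ker_resOfLe_of_cmScalar V p π r v hinf hsup hunit fE hfE hfEπ
    (cmScalar_localPoints_of_torsion V p r v fE hfE H)

omit [V.IsElliptic] in
/-- **The canonical extension is the isogeny's local points map.** If the isogeny `φ` acting as `π` (`CMPrimes.exists_isogeny_apply_eq_cmEndo`)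
satisfies the arbitrary-torsion CM scalar statement for `φ.localPointsMap K_v` (`Γ_{K_v}`-equivariant and compatible with `π` by
`Isogeny.localPointsMap_smul`, `Isogeny.localPointsMap_pointsMap`), then the existential input (H1-pts) of
`padicValNat_trueSelmer_quotient_eq_sha_of_frame_of_cmScalar` / `rBV_of_factor_values_of_cmScalar` holds. [cite: SilvermanAEC2009, III.4 Thm. 4.8]
[cite: GreenbergLNM1716, §2 Prop. 2.1 (p. 72)] -/
theorem cmScalar_input_of_isogeny (φ : WeierstrassCurve.Isogeny V V) (hφ : ∀ P, φ P = (π : AddMonoid.End V.geomPoints) P)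
    (H : ∀ y : localPoints V (v.adicCompletion K), (∀ σ : absoluteGaloisGroup (v.adicCompletion K), σ • y = y) →
      ∀ n : ℕ, ∃ (y' : localPoints V (v.adicCompletion K)) (N₁ : ℤ) (m : ℤ),
        (∀ σ : absoluteGaloisGroup (v.adicCompletion K), σ • y' = y') ∧ m ≠ 0 ∧
        ((N₁ : ℤ_[p]) - (1 - r)) ∈ (Ideal.span {(p : ℤ_[p]) ^ n} : Ideal ℤ_[p]) ∧
        m • (φ.localPointsMap (v.adicCompletion K) y - N₁ • y - p ^ n • y') = 0) :
    ∃ fE : localPoints V (v.adicCompletion K) →+ localPoints V (v.adicCompletion K),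
      (∀ (τ : absoluteGaloisGroup (v.adicCompletion K)) (Q : localPoints V (v.adicCompletion K)), fE (τ • Q) = τ • fE Q) ∧
      (∀ Q : V.geomPoints, fE (pointsMap V (v.adicCompletion K) Q) =
          pointsMap V (v.adicCompletion K) ((π : AddMonoid.End V.geomPoints) Q)) ∧
      ∀ y : localPoints V (v.adicCompletion K), (∀ σ : absoluteGaloisGroup (v.adicCompletion K), σ • y = y) →
        ∀ n : ℕ, ∃ (y' : localPoints V (v.adicCompletion K)) (N₁ : ℤ) (k : ℕ),
          (∀ σ : absoluteGaloisGroup (v.adicCompletion K), σ • y' = y') ∧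
          ((N₁ : ℤ_[p]) - (1 - r)) ∈ (Ideal.span {(p : ℤ_[p]) ^ n} : Ideal ℤ_[p]) ∧
          p ^ k • (fE y - N₁ • y - p ^ n • y') = 0 :=
  ⟨φ.localPointsMap _, φ.localPointsMap_smul _, fun Q ↦ by rw [φ.localPointsMap_pointsMap, hφ],
    cmScalar_localPoints_of_torsion V p r v _ (φ.localPointsMap_smul _) H⟩

end Local

end Summit.BirchSwinnertonDyer.BirchSwinnertonDyer.Theorems.PrintCf2.CMPrimes

end
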